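import Literature.Probability.RandomPlanarGeometry.HullHausdorffKernel
import Literature.Probability.RandomPlanarGeometry.LoewnerBoundaryExtension
import Literature.Probability.RandomPlanarGeometry.LoewnerHullCapacity
import Literature.Probability.RandomPlanarGeometry.SlitLoewnerNested
import HarnessLib

/-!
# The driving function is controlled by the extent of the curve

Topic `Literature/Probability/RandomPlanarGeometry` (family `crit-ising`); theorems only, no
definition and no named fact.

A. Kemppainen, S. Smirnov, *Random curves, scaling limits and Loewner evolutions*, Ann. Probab.
45 (2017), §3.3, eq. (10) and the paragraph before Prop. 3.7 (arXiv:1212.6215 p. 16): the tail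
of the driving process at a capacity time is controlled by an exit event of the curve from a
rectangle `R_{L,u} = [-L, L] × [0, u]` — "if `K ⊂ R_{L,u}` … `.9 L ≤ g_K(z) ≤ 1.1 L`" (Lemma A.11)
"… Based on this `P(|W(u²/4)| ≥ 2L) ≤ P(Re γ(τ_{R_{L,u}}) = ±L)`". The deterministic content
is that **the driving value `W_t` cannot be large unless the curve `γ[0, t]` has travelled far**.

This file PROVES that content with Lawler's crude constant (`|g_A(z) - z| ≤ 3 rad(A)`,
Lawler (2005), (3.12); tree form `IsHydrodynamicMap.norm_sub_self_le` with constant `580`):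

* `Loewner.IsGeneratedByCurve.norm_sub_driving_le` — **`|γ(t) - W_t| ≤ 580 r`** whenever
  `γ[0, t] ⊆ B̄(0, r)`: `γ(t) = f̄_t(W_t)` is the limit of `f_t(w)` as `w → W_t` in `ℍ`
  (`bdryInv_driving`, `tendsto_bdryInv`), and `|f_t(w) - w| = |z - g_t(z)| ≤ 580 r`;
* `Loewner.IsGeneratedByCurve.abs_driving_le` — **`|W_t| ≤ 581 r`** under the same hypothesis;
* `Loewner.IsGeneratedByCurve.im_le_two_mul_sqrt` — `im γ(s) ≤ 2 √t` for `s ≤ t` (the height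
  bound `(im z)² ≤ 4t` on `K_t`, Lawler Thm. 4.6, `Loewner.im_sq_le_of_mem_hull`);
* `Loewner.IsGeneratedByCurve.abs_driving_le_of_abs_re_le` — **the rectangle form**: if
  `|re γ(s)| ≤ L` for `s ≤ t` then `|W_t| ≤ 581 (L + 2 √t)`; contrapositively, `|W_t| > 581 (L +
  2√t)` forces `γ` to leave the strip `{|re| ≤ L}` (through the sides of `R_{L, 2√t}`, the top
  being out of reach by the height bound) before capacity time `t` — KS's inequality (10) with
  `581` in place of `2`.

## References

* A. Kemppainen, S. Smirnov, Ann. Probab. 45 (2017), §3.3 eq. (10), App. A Lemma A.11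
  (arXiv:1212.6215, p. 16 and Lemma 5.11). [KemppainenSmirnov2017]
* G. F. Lawler, *Conformally Invariant Processes in the Plane*, AMS (2005), §3.4 (3.12),
  §4.1 Thm. 4.6, Prop. 4.31 / Rem. 4.32. [Lawler2005]
-/

noncomputable section

open Set Filter Topology Metric Bornology Complex Function
open UpperHalfPlane (upperHalfPlaneSet isOpen_upperHalfPlaneSet)
open scoped NNReal

namespace Literature.Probability.RandomPlanarGeometry

namespace Loewner

variable {W : ℝ≥0 → ℝ} {γ : ℝ≥0 → ℂ}

/-- The hull of a curve-generated chain at time `t` lies (within `ℍ`) in any closed disc about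
`0` containing `γ[0, t]`. [cite: Lawler2005, Ch. 4 §4.1] -/
theorem IsGeneratedByCurve.hull_inter_subset_closedBall (hγ : IsGeneratedByCurve W γ) {t : ℝ≥0}
    {r : ℝ} (hr : γ '' Icc 0 t ⊆ closedBall (0 : ℂ) r) :
    hull W t ∩ upperHalfPlaneSet ⊆ closedBall ((0 : ℝ) : ℂ) r := by
  refine inter_subset_closedBall_of_diff_eq hr ?_
  rw [hγ.hull_eq, sdiff_sdiff_cancel_left]
  exact (unboundedComponent_subset _).trans sdiff_subset

/-- **`|f_t(w) - w| ≤ 580 r` on `ℍ`** when `γ[0, t] ⊆ B̄(0, r)`: the inverse Loewner map moves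
points by at most `580 r` (Lawler (2005), (3.12), read through `z = f_t(w)`).
[cite: Lawler2005, §3.4 (3.12)] -/
theorem IsGeneratedByCurve.norm_bdryInv_sub_le (hγ : IsGeneratedByCurve W γ) (hW : Continuous W)
    {t : ℝ≥0} {r : ℝ} (hr0 : 0 < r) (hr : γ '' Icc 0 t ⊆ closedBall (0 : ℂ) r) {w : ℂ}
    (hw : w ∈ upperHalfPlaneSet) : ‖bdryInv W t w - w‖ ≤ 580 * r := by
  obtain ⟨φ, hφ⟩ := exists_conformalEquiv_map_holds hW t
  have hH := isHydrodynamicMap_of_eqOn hW t hφ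
  have hz : bdryInv W t w ∈ domain W t := bdryInv_mem_domain hW t hw
  have h1 := hH.norm_sub_self_le (hγ.hull_inter_subset_closedBall hr) hr0 hz
  rw [hφ hz, map_bdryInv hW t hw] at h1
  rwa [norm_sub_rev]

/-- **The tip is within `580 r` of the driving value**: `|γ(t) - W_t| ≤ 580 r` whenever
`γ[0, t] ⊆ B̄(0, r)` (`γ(t) = f̄_t(W_t) = lim_{w → W_t} f_t(w)` and `|f_t(w) - w| ≤ 580 r`).
[cite: Lawler2005, §3.4 (3.12) and Prop. 4.31] [cite: KemppainenSmirnov2017, App. A Lemma A.11] -/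
theorem IsGeneratedByCurve.norm_sub_driving_le (hγ : IsGeneratedByCurve W γ) (hW : Continuous W)
    {t : ℝ≥0} {r : ℝ} (hr0 : 0 < r) (hr : γ '' Icc 0 t ⊆ closedBall (0 : ℂ) r) :
    ‖γ t - W t‖ ≤ 580 * r := by
  have him : 0 ≤ ((W t : ℝ) : ℂ).im := by simp
  have hlim := hγ.tendsto_bdryInv hW t him
  rw [hγ.bdryInv_driving hW t] at hlim
  -- `w ↦ f_t(w) - w → γ t - W t` within `ℍ`
  have hlim' : Tendsto (fun w ↦ loewnerInv W t w - w) (𝓝[upperHalfPlaneSet] (W t : ℂ))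
      (𝓝 (γ t - W t)) :=
    hlim.sub (tendsto_nhdsWithin_of_tendsto_nhds (continuous_id.tendsto _))
  haveI : (𝓝[upperHalfPlaneSet] ((W t : ℝ) : ℂ)).NeBot :=
    mem_closure_iff_nhdsWithin_neBot.1 (mem_closure_upperHalfPlaneSet_iff.2 him)
  refine le_of_tendsto hlim'.norm ?_
  filter_upwards [self_mem_nhdsWithin] with w hw
  rw [← bdryInv_eq_of_mem hW t hw]
  exact hγ.norm_bdryInv_sub_le hW hr0 hr hw

/-- **`|W_t| ≤ 581 r` when `γ[0, t] ⊆ B̄(0, r)`.**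
[cite: KemppainenSmirnov2017, §3.3 eq. (10)] [cite: Lawler2005, §3.4 (3.12)] -/
theorem IsGeneratedByCurve.abs_driving_le (hγ : IsGeneratedByCurve W γ) (hW : Continuous W)
    {t : ℝ≥0} {r : ℝ} (hr0 : 0 < r) (hr : γ '' Icc 0 t ⊆ closedBall (0 : ℂ) r) :
    |W t| ≤ 581 * r := by
  have h1 := hγ.norm_sub_driving_le hW hr0 hr
  have h2 : ‖γ t‖ ≤ r := by
    simpa using hr ⟨t, ⟨bot_le, le_rfl⟩, rfl⟩
  have h3 : ‖((W t : ℝ) : ℂ)‖ ≤ ‖γ t‖ + ‖γ t - W t‖ := by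
    have := norm_sub_le (γ t) (γ t - W t)
    rwa [sub_sub_cancel] at this
  rw [Complex.norm_real, Real.norm_eq_abs] at h3
  linarith

/-- **The height of the curve: `im γ(s) ≤ 2 √t` for `s ≤ t`** (`(im z)² ≤ 4t` on `K_t`).
[cite: Lawler2005, Ch. 4 §4.1 Thm. 4.6] -/
theorem IsGeneratedByCurve.im_le_two_mul_sqrt (hγ : IsGeneratedByCurve W γ) (hW : Continuous W)
    {s t : ℝ≥0} (hst : s ≤ t) : (γ s).im ≤ 2 * Real.sqrt t := by
  rcases (hγ.2.2.1 s).eq_or_lt with h0 | hpos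
  · rw [← h0]; positivity
  · have hmem : γ s ∈ hull W t := by
      rw [hγ.hull_eq]
      exact ⟨hpos, fun hU ↦ (unboundedComponent_subset _ hU).2 ⟨s, ⟨bot_le, hst⟩, rfl⟩⟩
    have h1 := im_sq_le_of_mem_hull hW hmem
    have h2 : (2 * Real.sqrt t) ^ 2 = 4 * (t : ℝ) := by
      rw [mul_pow, Real.sq_sqrt (NNReal.coe_nonneg t)]; norm_num
    nlinarith [Real.sqrt_nonneg (t : ℝ), hpos.le]

/-- **Rectangle form (Kemppainen–Smirnov's (10), crude constant)**: if `|re γ(s)| ≤ L` for all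
`s ≤ t` then `|W_t| ≤ 581 (L + 2 √t)` — for `γ[0, t]` then lies in the rectangle
`[-L, L] × [0, 2√t] ⊆ B̄(0, L + 2√t)`. Equivalently: `|W_t| > 581 (L + 2√t)` forces the curve to
reach `{|re| = L}`, i.e. to exit `R_{L, 2√t}` through its vertical sides, before capacity time
`t`. [cite: KemppainenSmirnov2017, §3.3 eq. (10)] -/
theorem IsGeneratedByCurve.abs_driving_le_of_abs_re_le (hγ : IsGeneratedByCurve W γ)
    (hW : Continuous W) {t : ℝ≥0} {L : ℝ} (hL : 0 < L) (hre : ∀ s ≤ t, |(γ s).re| ≤ L) :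
    |W t| ≤ 581 * (L + 2 * Real.sqrt t) := by
  have hr0 : 0 < L + 2 * Real.sqrt t := by positivity
  refine hγ.abs_driving_le hW hr0 ?_
  rintro _ ⟨s, hs, rfl⟩
  rw [mem_closedBall, dist_zero_right]
  have h1 := hre s hs.2
  have h2 := hγ.im_le_two_mul_sqrt hW hs.2
  have h3 : 0 ≤ (γ s).im := hγ.2.2.1 s
  calc ‖γ s‖ ≤ |(γ s).re| + |(γ s).im| := Complex.norm_le_abs_re_add_abs_im _
    _ ≤ L + 2 * Real.sqrt t := by rw [abs_of_nonneg h3]; linarith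

/-- **Exit form**: if `|W_t| > 581 (L + 2√t)` then some `s ≤ t` has `|re γ(s)| > L` (the curve has
left the strip `{|re| ≤ L}` by capacity time `t`). [cite: KemppainenSmirnov2017, §3.3 eq. (10)] -/
theorem IsGeneratedByCurve.exists_abs_re_gt_of_abs_driving_gt (hγ : IsGeneratedByCurve W γ)
    (hW : Continuous W) {t : ℝ≥0} {L : ℝ} (hL : 0 < L)
    (hWt : 581 * (L + 2 * Real.sqrt t) < |W t|) : ∃ s ≤ t, L < |(γ s).re| := by
  by_contra h
  simp only [not_exists, not_and, not_lt] at h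
  exact absurd hWt (not_lt.2 (hγ.abs_driving_le_of_abs_re_le hW hL h))

end Loewner

end Literature.Probability.RandomPlanarGeometry
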